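import Literature.Computability.QuantumComplexity.PermanentPairingCount
import Summits.ValiantsHypothesis.ValiantsHypothesis.Theorems.PerDivisionHard.Negative.PerSupportBound

/-!
# Crux `DivisionGap.PerDivisionHard` (stmt-ValiantsHypothesis-5065), line `pair-descent-jss-endpoint` —
the POWERS rung, part Count: the typed vertex count along a monotone circuit

Engine of `perPow_complexity_lower` / `perDivisionHard_powers` (file `…PerPowers.lean`): for a
fan-in-two circuit `P` over `ℝ≥0` whose output `F` has all row sums and all column sums `M ≥ 1`
(e.g. `F ≤ per_n^M` coefficientwise) the permutations `π` whose PURE monomial `M • μ_π` occurs in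
`F` number at most `size(P) · n!/2^{⌊n/3⌋}` (`card_pure_mul_two_pow_le`).  This is the typed vertex
count of the idea card `Cruxes/PerDivisionHard/Ideas/typed-vertex-rectangles.md`
(planner-cruxidea-…-5065-2), a multiplicity-insensitive refinement of Jerrum–Snir's content bound
[JerrumSnir1982, §3–§4.3]:

* *Walk* (`exists_gate_rows_window`): the number of ROWS met by a polynomial is subadditive under
  `+`, `*` and scalars and is `≤ 1` on inputs; a nonzero typed output meets all `n` rows, so below
  it some gate value `p` meets `k` rows with `n/3 < k ≤ 2(n/3)` (Jerrum–Snir's walk towards the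
  inputs, with row support in place of degree).
* *Peel* (`exists_eval_eq_zeroAt_add` of the tree): `F = F₀ + p · q` with `F₀` the output after
  zeroing that gate; over `ℝ≥0` nothing cancels, so `supp p + supp q ⊆ supp F` TYPES `p`: all its
  monomials have the same row sums `ρ` and column sums `γ`, and `{ρ ≠ 0}` is its row support
  (`exists_sums_of_support_mul_subset`, `mem_image_fst_vars_iff`).
* *Type rigidity* (`card_pureServed_le`): a pure monomial `M • μ_π` inside `supp p + supp q` has
  its `p`-part on the cells `(π j, j)`, where row and column sums are read off: `ρ ∘ π = γ`; such
  `π` form at most one coset of the stabiliser of `{ρ ≠ 0}`,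
  `≤ k!(n-k)! = n!/C(n,k) ≤ n!/2^{⌊n/3⌋}` of them.
* *Count* (`card_pure_mul_two_pow_le`): induction on the number of nonzero gate values.
-/

noncomputable section

-- `Summit.ValiantsHypothesis.ValiantsHypothesis.…` is the tree's mandated single-conjunct layout
-- (Sub = Summit), so the duplicated namespace component is intended.
set_option linter.dupNamespace false

namespace Summit.ValiantsHypothesis.ValiantsHypothesis.Theorems.DivisionGapPerDivisionHard

open MvPolynomial Literature.Computability.AlgebraicComplexity
open Literature.Computability.AlgebraicComplexity.ArithCircuit
open Literature.Barriers.ValiantsHypothesis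
open Summit.ValiantsHypothesis.ValiantsHypothesis.Theorems.PerDivisionHard.Negative
open scoped NNReal Pointwise

variable {n : ℕ}

/-! ### Row support and the balanced walk -/

/-- Rows met by a scalar multiple are met by the polynomial. [folklore] -/
theorem image_fst_vars_smul_subset (c : ℝ≥0) (p : MvPolynomial (Fin n × Fin n) ℝ≥0) :
    (c • p).vars.image Prod.fst ⊆ p.vars.image Prod.fst := by
  refine Finset.image_subset_image ?_
  rw [smul_eq_C_mul]
  exact (vars_mul _ _).trans (by rw [vars_C, Finset.empty_union])

/-- Rows met by a polynomial whose variables lie among those of `p` and `q`, counted. [folklore] -/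
theorem card_image_fst_vars_le {p q r : MvPolynomial (Fin n × Fin n) ℝ≥0}
    (h : r.vars ⊆ p.vars ∪ q.vars) :
    (r.vars.image Prod.fst).card ≤
      (p.vars.image Prod.fst).card + (q.vars.image Prod.fst).card :=
  calc (r.vars.image Prod.fst).card ≤ ((p.vars ∪ q.vars).image Prod.fst).card :=
        Finset.card_le_card (Finset.image_subset_image h)
    _ ≤ _ := by rw [Finset.image_union]; exact Finset.card_union_le _ _

/-- A gate with at most two operands whose value meets more than `2m` rows has an operand whose
value meets more than `m` rows (row support is subadditive under `+`, `*`, scalars). [folklore] -/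
theorem exists_arg_rows_gt (vals : List (MvPolynomial (Fin n × Fin n) ℝ≥0)) (m : ℕ) :
    ∀ g : Gate ℝ≥0 (Fin n × Fin n), g.fanIn ≤ 2 →
      2 * m < ((g.eval vals).vars.image Prod.fst).card →
      ∃ u ∈ g.args, m < ((u.eval vals).vars.image Prod.fst).card
  | .sum [], _, h => by simp [Gate.eval] at h
  | .sum [a], _, h => by
    refine ⟨a.2, by simp [Gate.args], ?_⟩
    simp only [Gate.eval, List.map_cons, List.map_nil, List.sum_cons, List.sum_nil,
      add_zero] at h
    have ha := Finset.card_le_card (image_fst_vars_smul_subset a.1 (a.2.eval vals))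
    omega
  | .sum [a, b], _, h => by
    simp only [Gate.eval, List.map_cons, List.map_nil, List.sum_cons, List.sum_nil,
      add_zero] at h
    have h' := card_image_fst_vars_le
      (vars_add_subset (a.1 • a.2.eval vals) (b.1 • b.2.eval vals))
    have ha := Finset.card_le_card (image_fst_vars_smul_subset a.1 (a.2.eval vals))
    have hb := Finset.card_le_card (image_fst_vars_smul_subset b.1 (b.2.eval vals))
    rcases lt_or_ge m ((a.2.eval vals).vars.image Prod.fst).card with hlt | hge
    · exact ⟨a.2, by simp [Gate.args], hlt⟩
    · exact ⟨b.2, by simp [Gate.args], by omega⟩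
  | .sum (_ :: _ :: _ :: _), hlen, _ => by simp [Gate.fanIn, Gate.args] at hlen
  | .prod [], _, h => by simp [Gate.eval, vars_one] at h
  | .prod [u], _, h => by
    refine ⟨u, by simp [Gate.args], ?_⟩
    simp only [Gate.eval, List.map_cons, List.map_nil, List.prod_cons, List.prod_nil,
      mul_one] at h
    omega
  | .prod [u, v], _, h => by
    simp only [Gate.eval, List.map_cons, List.map_nil, List.prod_cons, List.prod_nil,
      mul_one] at h
    have h' := card_image_fst_vars_le (vars_mul (u.eval vals) (v.eval vals))
    rcases lt_or_ge m ((u.eval vals).vars.image Prod.fst).card with hlt | hge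
    · exact ⟨u, by simp [Gate.args], hlt⟩
    · exact ⟨v, by simp [Gate.args], by omega⟩
  | .prod (_ :: _ :: _ :: _), hlen, _ => by simp [Gate.fanIn, Gate.args] at hlen

/-- **The balanced walk (row support in place of degree).** In a fan-in-two circuit over `ℝ≥0`,
if the value of gate `w` meets more than `2m ≥ 2` rows, some gate value meets `k` rows with
`m < k ≤ 2m`: walk towards the inputs through an operand carrying more than half of the rows;
inputs meet at most one row, so the walk stays on earlier gates until it enters the window.
[cite: JerrumSnir1982, §3.3 (proof of Thm. 3.4)] -/
theorem exists_gate_rows_window (gs : List (Gate ℝ≥0 (Fin n × Fin n)))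
    (h2 : ∀ g ∈ gs, g.fanIn ≤ 2) {m : ℕ} (hm : 1 ≤ m) (w : ℕ)
    (hw : 2 * m < (((gateValues gs).getD w 0).vars.image Prod.fst).card) :
    ∃ v : ℕ, m < (((gateValues gs).getD v 0).vars.image Prod.fst).card ∧
      (((gateValues gs).getD v 0).vars.image Prod.fst).card ≤ 2 * m := by
  induction w using Nat.strong_induction_on with
  | _ w ih =>
    rcases hg : gs[w]? with _ | g
    · rw [getD_gateValues_eq_zero hg] at hw; simp at hw
    rw [getD_gateValues hg] at hw
    obtain ⟨u, -, hu⟩ :=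
      exists_arg_rows_gt ((gateValues gs).take w) m g (h2 g (List.mem_of_getElem? hg)) hw
    cases u with
    | var e =>
      rw [show (Operand.var e : Operand ℝ≥0 (Fin n × Fin n)).eval ((gateValues gs).take w) = X e
        from rfl, vars_X, Finset.image_singleton, Finset.card_singleton] at hu
      omega
    | const c =>
      rw [show (Operand.const c : Operand ℝ≥0 (Fin n × Fin n)).eval ((gateValues gs).take w) = C c
        from rfl, vars_C, Finset.image_empty, Finset.card_empty] at hu
      omega
    | gate j =>
      rw [Operand.eval_gate, getD_take_gateValues] at hu
      split_ifs at hu with hjw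
      · by_cases hle : (((gateValues gs).getD j 0).vars.image Prod.fst).card ≤ 2 * m
        · exact ⟨j, hu, hle⟩
        · exact ih j hjw (by omega)
      · simp at hu

/-! ### Typing over `ℝ≥0` -/

/-- For a typed `p ≠ 0` (all monomials have the row sums `ρ`), row `i` is met by `p` iff
`ρ i ≠ 0`. [folklore] -/
theorem mem_image_fst_vars_iff {p : MvPolynomial (Fin n × Fin n) ℝ≥0} {ρ : Fin n → ℕ}
    (hp : ∀ α ∈ p.support, ∀ i, ∑ j, α (i, j) = ρ i) (h0 : p ≠ 0) (i : Fin n) :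
    i ∈ p.vars.image Prod.fst ↔ ρ i ≠ 0 := by
  obtain ⟨α₀, hα₀⟩ := support_nonempty.mpr h0
  simp only [Finset.mem_image, mem_vars_iff_mem_support, Prod.exists, exists_and_right,
    exists_eq_right]
  constructor
  · rintro ⟨j, α, hα, hij⟩ h
    rw [← hp α hα i] at h
    exact (Finsupp.mem_support_iff.mp hij) (Finset.sum_eq_zero_iff.mp h j (Finset.mem_univ _))
  · intro hi
    rw [← hp α₀ hα₀ i] at hi
    obtain ⟨j, -, hj⟩ := Finset.exists_ne_zero_of_sum_ne_zero hi
    exact ⟨j, α₀, hα₀, Finsupp.mem_support_iff.mpr hj⟩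

/-- Gate typing: if `supp (p * q) ⊆ supp g` with `q ≠ 0` and every monomial of `g` has all row
sums and all column sums equal to `M`, then all monomials of `p` have common row sums `ρ` and
column sums `γ` (those of `g` minus those of one fixed monomial of `q`; no cancellation over
`ℝ≥0`). [cite: JerrumSnir1982, §3.1 (Lemma 3.1(iii))] -/
theorem exists_sums_of_support_mul_subset {g p q : MvPolynomial (Fin n × Fin n) ℝ≥0}
    {M : ℕ} (hg : ∀ α ∈ g.support, (∀ i, ∑ j, α (i, j) = M) ∧ (∀ j, ∑ i, α (i, j) = M))
    (hpq : (p * q).support ⊆ g.support) (hq : q ≠ 0) :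
    ∃ ρ γ : Fin n → ℕ,
      ∀ α ∈ p.support, (∀ i, ∑ j, α (i, j) = ρ i) ∧ (∀ j, ∑ i, α (i, j) = γ j) := by
  obtain ⟨β, hβ⟩ := support_nonempty.mpr hq
  refine ⟨fun i => M - ∑ j, β (i, j), fun j => M - ∑ i, β (i, j), fun α hα => ?_⟩
  obtain ⟨hr, hc⟩ :=
    hg _ (hpq (Literature.Barriers.ValiantsHypothesis.add_mem_support_mul hα hβ))
  refine ⟨fun i => ?_, fun j => ?_⟩
  · have h := hr i
    simp only [Finsupp.coe_add, Pi.add_apply, Finset.sum_add_distrib] at h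
    show ∑ j, α (i, j) = M - ∑ j, β (i, j)
    omega
  · have h := hc j
    simp only [Finsupp.coe_add, Pi.add_apply, Finset.sum_add_distrib] at h
    show ∑ i, α (i, j) = M - ∑ i, β (i, j)
    omega

/-! ### Type rigidity of the pure monomials -/

/-- **Type rigidity.** If all monomials of `p` have row sums `ρ` and column sums `γ`, the
permutations `π` whose pure monomial `M • μ_π` is a monomial of `p * q` satisfy `ρ ∘ π = γ` (the
`p`-part of `M • μ_π` lives on the cells `(π j, j)`, where both sums are read off), hence form at
most one coset of the stabiliser of the row support `{i | ρ i ≠ 0}`: at most `k! · (n - k)!` of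
them, `k = #{i | ρ i ≠ 0}`. [folklore] -/
theorem card_pureServed_le {p q : MvPolynomial (Fin n × Fin n) ℝ≥0} {ρ γ : Fin n → ℕ} (M : ℕ)
    (hp : ∀ α ∈ p.support, (∀ i, ∑ j, α (i, j) = ρ i) ∧ (∀ j, ∑ i, α (i, j) = γ j)) :
    (Finset.univ.filter fun π : Equiv.Perm (Fin n) =>
        M • permMonomial π ∈ (p * q).support).card ≤
      (Finset.univ.filter fun i => ρ i ≠ 0).card.factorial *
        (n - (Finset.univ.filter fun i => ρ i ≠ 0).card).factorial := by
  set Z : Finset (Fin n) := Finset.univ.filter fun i => ρ i ≠ 0 with hZ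
  set T : Finset (Equiv.Perm (Fin n)) := Finset.univ.filter fun π => ∀ j, ρ (π j) = γ j with hT
  -- served permutations are typed
  have h1 : (Finset.univ.filter fun π : Equiv.Perm (Fin n) =>
      M • permMonomial π ∈ (p * q).support) ⊆ T := by
    intro π hπ
    simp only [Finset.mem_filter, Finset.mem_univ, true_and, hT] at hπ ⊢
    obtain ⟨α, hα, β, -, hαβ⟩ := Finset.mem_add.mp (support_mul p q hπ)
    have hcell : ∀ i j, α (i, j) ≠ 0 → π j = i := by
      intro i j hij
      have h := DFunLike.congr_fun hαβ (i, j)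
      simp only [Finsupp.coe_add, Pi.add_apply, Finsupp.coe_smul, Pi.smul_apply, smul_eq_mul,
        permMonomial_apply] at h
      by_contra hne
      rw [if_neg hne, mul_zero] at h
      omega
    intro j
    obtain ⟨hr, hc⟩ := hp α hα
    have e1 : ∑ j', α (π j, j') = α (π j, j) := by
      refine Finset.sum_eq_single j (fun j' _ hj' => ?_) (by simp)
      by_contra h
      exact hj' (π.injective (hcell _ _ h))
    have e2 : ∑ i, α (i, j) = α (π j, j) := by
      refine Finset.sum_eq_single (π j) (fun i _ hi => ?_) (by simp)
      by_contra h
      exact hi (hcell i j h).symm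
    rw [← hr (π j), ← hc j, e1, e2]
  -- typed permutations form at most one coset of the stabiliser of `Z`
  have h3 := Literature.Computability.QuantumComplexity.PermanentPairing.card_perm_stabilising Z
  rw [Fintype.card_fin] at h3
  rw [← h3]
  refine (Finset.card_le_card h1).trans ?_
  rcases T.eq_empty_or_nonempty with hT0 | ⟨π₀, hπ₀⟩
  · rw [hT0]; exact Nat.zero_le _
  have h0 : ∀ j, ρ (π₀ j) = γ j := (Finset.mem_filter.mp hπ₀).2
  refine Finset.card_le_card_of_injOn (fun π => π * π₀⁻¹) (fun π hπ => ?_)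
    (fun π _ π' _ h => mul_right_cancel h)
  have hπ' : ∀ j, ρ (π j) = γ j := (Finset.mem_filter.mp (Finset.mem_coe.mp hπ)).2
  simp only [Finset.coe_filter, Finset.mem_univ, true_and, Set.mem_setOf_eq, hZ,
    Finset.mem_filter]
  intro i
  rw [show (π * π₀⁻¹) i = π (π₀.symm i) from rfl, hπ' (π₀.symm i), ← h0 (π₀.symm i),
    Equiv.apply_symm_apply]

/-! ### The covering count -/

/-- Below a nonzero output all of whose monomials have row sums `M ≥ 1` (so it meets all `n ≥ 3`
rows) some gate value meets `k` rows with `n/3 < k ≤ 2(n/3)`. [cite: JerrumSnir1982, §3.3] -/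
theorem exists_rows_window_of_eval_ne_zero (hn : 3 ≤ n) {M : ℕ} (hM : 1 ≤ M)
    (P : ArithCircuit ℝ≥0 (Fin n × Fin n)) (h2 : P.IsFanInTwo)
    (hP : ∀ α ∈ P.eval.support, ∀ i, ∑ j, α (i, j) = M) (h0 : P.eval ≠ 0) :
    ∃ v : ℕ, n / 3 < (((gateValues P.gates).getD v 0).vars.image Prod.fst).card ∧
      (((gateValues P.gates).getD v 0).vars.image Prod.fst).card ≤ 2 * (n / 3) := by
  have huniv : P.eval.vars.image Prod.fst = Finset.univ :=
    Finset.eq_univ_of_forall fun i => (mem_image_fst_vars_iff hP h0 i).mpr (by omega)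
  have hcard : 2 * (n / 3) < (P.eval.vars.image Prod.fst).card := by
    rw [huniv, Finset.card_univ, Fintype.card_fin]; omega
  have heval : P.eval = P.output.eval (gateValues P.gates) := rfl
  rcases hout : P.output with e | c | j
  · rw [heval, hout, show (Operand.var e : Operand ℝ≥0 (Fin n × Fin n)).eval (gateValues P.gates)
      = X e from rfl, vars_X, Finset.image_singleton, Finset.card_singleton] at hcard
    omega
  · rw [heval, hout, show (Operand.const c : Operand ℝ≥0 (Fin n × Fin n)).eval
      (gateValues P.gates) = C c from rfl, vars_C, Finset.image_empty, Finset.card_empty] at hcard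
    omega
  · rw [heval, hout, Operand.eval_gate] at hcard
    exact exists_gate_rows_window P.gates h2 (by omega) j hcard

/-- **Covering count (the typed vertex bound along the peeling).** Let `P` be a fan-in-two circuit
over `ℝ≥0` whose gate values vanish outside a set of at most `N` indices and whose output has all
row sums and all column sums equal to `M ≥ 1` (e.g. `P.eval ≤ per_n^M` coefficientwise), `n ≥ 3`.
Then the permutations `π` whose pure monomial `M • μ_π` occurs in `P.eval` number at most
`N · n!/2^{⌊n/3⌋}`.  Induction on `N`: zero a gate `v` whose value `p` meets `k ∈ (n/3, 2(n/3)]`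
rows (`exists_rows_window_of_eval_ne_zero`); `P.eval = (P.zeroAt v).eval + p · q`
(`exists_eval_eq_zeroAt_add`), `p` is typed by `supp (p · q) ⊆ supp P.eval`, its pure monomials
serve at most `k!(n-k)!` permutations (`card_pureServed_le`) and `k!(n-k)! · 2^{⌊n/3⌋} ≤
k!(n-k)! · C(n,k) = n!` (`two_pow_le_choose_middle`); `P.zeroAt v` has one nonzero value fewer.
[folklore] -/
theorem pure_cover_count (hn : 3 ≤ n) {M : ℕ} (hM : 1 ≤ M) :
    ∀ (N : ℕ) (P : ArithCircuit ℝ≥0 (Fin n × Fin n)), P.IsFanInTwo →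
      (∃ Z : Finset ℕ, Z.card ≤ N ∧ ∀ j ∉ Z, (gateValues P.gates).getD j 0 = 0) →
      (∀ α ∈ P.eval.support, (∀ i, ∑ j, α (i, j) = M) ∧ (∀ j, ∑ i, α (i, j) = M)) →
      (Finset.univ.filter fun π : Equiv.Perm (Fin n) =>
          M • permMonomial π ∈ P.eval.support).card * 2 ^ (n / 3) ≤ N * n.factorial := by
  classical
  intro N
  induction N with
  | zero =>
    rintro P h2 ⟨Z, hZc, hZ0⟩ hg
    by_cases h0 : P.eval = 0
    · simp [h0]
    · exfalso
      obtain ⟨v, hlo, -⟩ :=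
        exists_rows_window_of_eval_ne_zero hn hM P h2 (fun α hα => (hg α hα).1) h0
      rw [hZ0 v (by simp [Finset.card_eq_zero.mp (Nat.le_zero.mp hZc)]), vars_0,
        Finset.image_empty, Finset.card_empty] at hlo
      omega
  | succ N ih =>
    rintro P h2 ⟨Z, hZc, hZ0⟩ hg
    by_cases h0 : P.eval = 0
    · simp [h0]
    obtain ⟨v, hlo, hhi⟩ :=
      exists_rows_window_of_eval_ne_zero hn hM P h2 (fun α hα => (hg α hα).1) h0
    obtain ⟨q, hq⟩ := exists_eval_eq_zeroAt_add P v
    have hlink := linked_gateValues_set P.gates v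
    set p := (gateValues P.gates).getD v 0 with hpdef
    have hp0 : p ≠ 0 := by
      intro h
      rw [h, vars_0, Finset.image_empty, Finset.card_empty] at hlo
      omega
    have hvZ : v ∈ Z := by_contra fun h => hp0 (hZ0 v h)
    -- the zeroed circuit: values vanish at `v` and wherever they vanished before
    have hZ' : ∃ Z' : Finset ℕ, Z'.card ≤ N ∧
        ∀ j ∉ Z', (gateValues (P.zeroAt v).gates).getD j 0 = 0 := by
      refine ⟨Z.erase v, ?_, fun j hj => ?_⟩
      · rw [Finset.card_erase_of_mem hvZ]; omega
      · obtain ⟨h, hh⟩ := hlink.2 j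
        by_cases hjv : j = v
        · subst hjv
          rcases lt_or_ge j P.gates.length with hjl | hjl
          · rw [show (P.zeroAt j).gates = P.gates.set j zeroGate from rfl,
              getD_gateValues (List.getElem?_set_self hjl)]
            simp [zeroGate, Gate.eval]
          · exact absurd (getD_gateValues_eq_zero (List.getElem?_eq_none_iff.mpr hjl)) hp0
        · have hjZ : j ∉ Z := fun h => hj (Finset.mem_erase.mpr ⟨hjv, h⟩)
          rw [hZ0 j hjZ] at hh
          have hs := support_subset_of_eq_add hh
          rwa [support_zero, Finset.subset_empty, support_eq_empty] at hs
    have hg' : ∀ α ∈ (P.zeroAt v).eval.support,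
        (∀ i, ∑ j, α (i, j) = M) ∧ (∀ j, ∑ i, α (i, j) = M) :=
      fun α hα => hg α (support_subset_of_eq_add hq hα)
    have hIH := ih (P.zeroAt v) (h2.zeroAt v) hZ' hg'
    -- the pure monomials of `P.eval` are those of the zeroed circuit or of the term `p * q`
    set G : Finset (Equiv.Perm (Fin n)) :=
      Finset.univ.filter fun π => M • permMonomial π ∈ (p * q).support with hG
    have hcover : (Finset.univ.filter fun π : Equiv.Perm (Fin n) =>
        M • permMonomial π ∈ P.eval.support) ⊆
        (Finset.univ.filter fun π : Equiv.Perm (Fin n) =>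
          M • permMonomial π ∈ (P.zeroAt v).eval.support) ∪ G := by
      intro π hπ
      simp only [Finset.mem_filter, Finset.mem_union, Finset.mem_univ, true_and, hG] at hπ ⊢
      rw [hq] at hπ
      exact Finset.mem_union.mp (support_add hπ)
    -- the term serves at most `n!/2^{n/3}` permutations
    have hGle : G.card * 2 ^ (n / 3) ≤ n.factorial := by
      by_cases hq0 : q = 0
      · simp [hG, hq0]
      have hsub : (p * q).support ⊆ P.eval.support :=
        support_subset_of_eq_add (hq.trans (add_comm _ _))
      obtain ⟨ρ, γ, hty⟩ := exists_sums_of_support_mul_subset hg hsub hq0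
      set k := (Finset.univ.filter fun i => ρ i ≠ 0).card with hk
      have hkrows : (p.vars.image Prod.fst).card = k := by
        rw [hk]
        congr 1
        ext i
        simpa using mem_image_fst_vars_iff (fun α hα => (hty α hα).1) hp0 i
      rw [hkrows] at hlo hhi
      have hkn : k ≤ n := by omega
      calc G.card * 2 ^ (n / 3) ≤ k.factorial * (n - k).factorial * n.choose k :=
            Nat.mul_le_mul (card_pureServed_le M hty) (two_pow_le_choose_middle hlo hhi)
        _ = n.factorial := by
            rw [mul_comm, ← mul_assoc]; exact Nat.choose_mul_factorial_mul_factorial hkn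
    calc (Finset.univ.filter fun π : Equiv.Perm (Fin n) =>
            M • permMonomial π ∈ P.eval.support).card * 2 ^ (n / 3)
        ≤ ((Finset.univ.filter fun π : Equiv.Perm (Fin n) =>
            M • permMonomial π ∈ (P.zeroAt v).eval.support).card + G.card) * 2 ^ (n / 3) :=
          Nat.mul_le_mul_right _
            ((Finset.card_le_card hcover).trans (Finset.card_union_le _ _))
      _ ≤ N * n.factorial + n.factorial := by rw [add_mul]; exact add_le_add hIH hGle
      _ = (N + 1) * n.factorial := by ring

/-- **The typed vertex count** (registered form of `pure_cover_count`): for a fan-in-two circuit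
`P` over `ℝ≥0` with at most `N` nonzero gate values whose output has all row and column sums
`M ≥ 1`, `n ≥ 3`, at most `N · n!/2^{⌊n/3⌋}` permutations `π` have their pure monomial `M • μ_π`
in `supp P.eval`. [folklore] -/
theorem card_pure_mul_two_pow_le :
    ∀ (n M N : ℕ) (P : ArithCircuit ℝ≥0 (Fin n × Fin n)), 3 ≤ n → 1 ≤ M → P.IsFanInTwo →
      (∃ Z : Finset ℕ, Z.card ≤ N ∧ ∀ j ∉ Z, (gateValues P.gates).getD j 0 = 0) →
      (∀ α ∈ P.eval.support, (∀ i, ∑ j, α (i, j) = M) ∧ (∀ j, ∑ i, α (i, j) = M)) →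
      (Finset.univ.filter fun π : Equiv.Perm (Fin n) =>
          M • permMonomial π ∈ P.eval.support).card * 2 ^ (n / 3) ≤ N * n.factorial :=
  fun _ _ N P hn hM => pure_cover_count hn hM N P

end Summit.ValiantsHypothesis.ValiantsHypothesis.Theorems.DivisionGapPerDivisionHard

end
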